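import Summits.Ventures.Crystal3D.Bulk.GapKiteCalculus
import Summits.Ventures.Crystal3D.Bulk.GapKiteCurve
import HarnessLib

/-!
# A kite row is bounded by its value at one END of the family whenever its quadratic keeps a sign
# — for every admissible configuration; plus box certificates for that sign

HONEST FRAMING. Part of the venture `Summits/Ventures/Crystal3D` (cell `pub-crystal3d`, phase 2;
seat p2, PROMOTION-AUDIT prep, memo r1.1 A6 (b1): the B-lineage hole-quadrilateral tables `PZ4_I`
/ `PZ4_W1`). Kernel theorems about an ADMISSIBLE fourteen-ball configuration `c` (`IsGapConfig c`;
no extremality, NO convexity / face hypothesis); nothing here asserts anything about GAP(1.26); no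
census number, head, class or grade word moves.

For a P-kite `(p, a, b, e)` (shell balls `a ≠ e` touching the intruder, `b` touching `a, e`) with
corners `u₁ = corner c a 13 b` (`= u₃ = corner c e 13 b`), `u₂ = corner c 13 a e`,
`u₄ = corner c b a e`, and a row `α u₁ + c₂ u₂ + c₄ u₄` (`α = c₁ + c₃`) with quadratic
`q_D(y) = α y² − (c₂ + c₄ D) y + (c₂ D + c₄ − α)` (`Bulk/GapKiteCalculus.lean`):

* **`IsGapConfig.kite_row_le_half`** — if `q_D ≥ 0` on `[x♭(D), D/2]` then
  `α u₁ + c₂ u₂ + c₄ u₄ ≤ (α + 2c₄) A_x(D) + 2c₂ A_p(D)` (the value at `|pb| = ρ`);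
* **`IsGapConfig.kite_row_le_flat`** — if `q_D ≤ 0` there then
  `α u₁ + c₂ u₂ + c₄ u₄ ≤ α A_x(D) + c₂ A_p(D) + (α + c₄) α₀` (the value at `|ae| = 60°`);
  (`IsGapConfig.kite_on_curve` + `kiteRow_le_of_quad_nonneg` / `kiteRow_ge_of_quad_nonpos` + the
  end values of `Bulk/GapKiteCurve.lean`; `D² < 2`);
* §1 **box certificates** for the hypothesis on a `D`-cell: `q_D(y)` is affine in `D`, so Lukács
  certificates `q_{D_lo}(y) = p (y − v)² + m + l (y − X_lo)(X_hi − y)` (`p, m, l ≥ 0`) at the two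
  ends of the cell give its sign on the box `[D_lo, D_hi] × [X_lo, X_hi] ⊇ {(D, y) : x♭(D) ≤ y ≤ D/2}`
  (`kite_quad_nonneg_of_cert`, `kite_quad_nonpos_of_cert`, `kite_flat_mono`, `kite_le_flat_of_sq`);
  the `_of_cert` forms of the two theorems take exactly these rational data (one `ring` per end);
* **valley rows** `IsGapConfig.kite_row_le_max_of_concave` (`α ≤ 0` and `q_D(D/2) ≥ 0`: `q` is
  negative-then-nonnegative, the row is at most the larger END value; `kite_quad_nonneg_between`)
  and **peak rows** `IsGapConfig.kite_row_le_at` (`q ≥ 0` before `s`, `≤ 0` after `s`: the row is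
  at most its value AT `s`), with `IsGapConfig.kite_row_le_at_zero_of_cert` (`s = 0`, `|pb| = 90°`:
  value `α(π − A_x) + c₂(π − A_p) + c₄ arccos((2D² − 3)/3)`).
-/

noncomputable section

open scoped BigOperators InnerProductSpace
open Finset Real Set

namespace Summit.Ventures.Crystal3D

/-! ## §1 Box certificates for the sign of the kite quadratic -/

/-- A Lukács certificate is nonnegative on its interval. -/
theorem quad_cert_nonneg {y lo hi p v m l : ℝ} (h1 : lo ≤ y) (h2 : y ≤ hi) (hp : 0 ≤ p)
    (hm : 0 ≤ m) (hl : 0 ≤ l) : 0 ≤ p * (y - v) ^ 2 + m + l * ((y - lo) * (hi - y)) := by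
  have := mul_nonneg hl (mul_nonneg (sub_nonneg.2 h1) (sub_nonneg.2 h2))
  nlinarith [sq_nonneg (y - v)]

/-- **Box criterion (`q ≥ 0`).** The kite quadratic is affine in `D`: Lukács certificates for
`q_{D_lo}` and `q_{D_hi}` on `[X_lo, X_hi]` give `q_D(y) ≥ 0` for `D_lo ≤ D ≤ D_hi`,
`X_lo ≤ y ≤ X_hi`. -/
theorem kite_quad_nonneg_of_cert {α c₂ c₄ Dlo Dhi Xlo Xhi p₁ v₁ m₁ l₁ p₂ v₂ m₂ l₂ D y : ℝ}
    (hD1 : Dlo ≤ D) (hD2 : D ≤ Dhi) (hy1 : Xlo ≤ y) (hy2 : y ≤ Xhi)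
    (hp₁ : 0 ≤ p₁) (hm₁ : 0 ≤ m₁) (hl₁ : 0 ≤ l₁) (hp₂ : 0 ≤ p₂) (hm₂ : 0 ≤ m₂) (hl₂ : 0 ≤ l₂)
    (h₁ : ∀ t : ℝ, α * t ^ 2 - (c₂ + c₄ * Dlo) * t + (c₂ * Dlo + c₄ - α) =
      p₁ * (t - v₁) ^ 2 + m₁ + l₁ * ((t - Xlo) * (Xhi - t)))
    (h₂ : ∀ t : ℝ, α * t ^ 2 - (c₂ + c₄ * Dhi) * t + (c₂ * Dhi + c₄ - α) =
      p₂ * (t - v₂) ^ 2 + m₂ + l₂ * ((t - Xlo) * (Xhi - t))) :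
    0 ≤ α * y ^ 2 - (c₂ + c₄ * D) * y + (c₂ * D + c₄ - α) := by
  have q1 : 0 ≤ α * y ^ 2 - (c₂ + c₄ * Dlo) * y + (c₂ * Dlo + c₄ - α) := by
    rw [h₁ y]; exact quad_cert_nonneg hy1 hy2 hp₁ hm₁ hl₁
  have q2 : 0 ≤ α * y ^ 2 - (c₂ + c₄ * Dhi) * y + (c₂ * Dhi + c₄ - α) := by
    rw [h₂ y]; exact quad_cert_nonneg hy1 hy2 hp₂ hm₂ hl₂
  have e : (Dhi - Dlo) * (α * y ^ 2 - (c₂ + c₄ * D) * y + (c₂ * D + c₄ - α)) =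
      (Dhi - D) * (α * y ^ 2 - (c₂ + c₄ * Dlo) * y + (c₂ * Dlo + c₄ - α)) +
        (D - Dlo) * (α * y ^ 2 - (c₂ + c₄ * Dhi) * y + (c₂ * Dhi + c₄ - α)) := by
    ring
  rcases eq_or_lt_of_le (hD1.trans hD2) with h | h
  · have hD : D = Dlo := le_antisymm (h ▸ hD2) hD1
    rw [hD]; exact q1
  · have hrhs : (Dhi - Dlo) * 0 ≤
        (Dhi - Dlo) * (α * y ^ 2 - (c₂ + c₄ * D) * y + (c₂ * D + c₄ - α)) := by
      rw [mul_zero, e]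
      exact add_nonneg (mul_nonneg (by linarith) q1) (mul_nonneg (by linarith) q2)
    exact le_of_mul_le_mul_left hrhs (by linarith)

/-- **Box criterion (`q ≤ 0`)**: the same with certificates for `−q_{D_lo}`, `−q_{D_hi}`. -/
theorem kite_quad_nonpos_of_cert {α c₂ c₄ Dlo Dhi Xlo Xhi p₁ v₁ m₁ l₁ p₂ v₂ m₂ l₂ D y : ℝ}
    (hD1 : Dlo ≤ D) (hD2 : D ≤ Dhi) (hy1 : Xlo ≤ y) (hy2 : y ≤ Xhi)
    (hp₁ : 0 ≤ p₁) (hm₁ : 0 ≤ m₁) (hl₁ : 0 ≤ l₁) (hp₂ : 0 ≤ p₂) (hm₂ : 0 ≤ m₂) (hl₂ : 0 ≤ l₂)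
    (h₁ : ∀ t : ℝ, -(α * t ^ 2 - (c₂ + c₄ * Dlo) * t + (c₂ * Dlo + c₄ - α)) =
      p₁ * (t - v₁) ^ 2 + m₁ + l₁ * ((t - Xlo) * (Xhi - t)))
    (h₂ : ∀ t : ℝ, -(α * t ^ 2 - (c₂ + c₄ * Dhi) * t + (c₂ * Dhi + c₄ - α)) =
      p₂ * (t - v₂) ^ 2 + m₂ + l₂ * ((t - Xlo) * (Xhi - t))) :
    α * y ^ 2 - (c₂ + c₄ * D) * y + (c₂ * D + c₄ - α) ≤ 0 := by
  have h := kite_quad_nonneg_of_cert (α := -α) (c₂ := -c₂) (c₄ := -c₄) hD1 hD2 hy1 hy2 hp₁ hm₁ hl₁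
    hp₂ hm₂ hl₂ (fun t => by rw [← h₁ t]; ring) (fun t => by rw [← h₂ t]; ring)
  linarith

/-- The flat end `x♭(D) = (D − √(6 − 2D²))/3` is monotone in `D` (`0 ≤ D_lo ≤ D`). -/
theorem kite_flat_mono {Dlo D : ℝ} (h0 : 0 ≤ Dlo) (h1 : Dlo ≤ D) :
    (Dlo - √(6 - 2 * Dlo ^ 2)) / 3 ≤ (D - √(6 - 2 * D ^ 2)) / 3 := by
  have hs : √(6 - 2 * D ^ 2) ≤ √(6 - 2 * Dlo ^ 2) := Real.sqrt_le_sqrt (by nlinarith)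
  linarith

/-- A rational test for `X_lo ≤ x♭(D_lo)`: `6 − 2D_lo² ≤ (D_lo − 3X_lo)²` and `3X_lo ≤ D_lo`. -/
theorem kite_le_flat_of_sq {Dlo Xlo : ℝ} (h1 : 6 - 2 * Dlo ^ 2 ≤ (Dlo - 3 * Xlo) ^ 2)
    (h2 : 3 * Xlo ≤ Dlo) : Xlo ≤ (Dlo - √(6 - 2 * Dlo ^ 2)) / 3 := by
  have hs : √(6 - 2 * Dlo ^ 2) ≤ Dlo - 3 * Xlo := by
    rw [← Real.sqrt_sq (show (0:ℝ) ≤ Dlo - 3 * Xlo by linarith)]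
    exact Real.sqrt_le_sqrt h1
  linarith

/-- **Concavity.** A kite quadratic with `α ≤ 0` that is `≥ 0` at two parameters is `≥ 0` between
them (`(y₂ − y₁) q(y) = (y₂ − y) q(y₁) + (y − y₁) q(y₂) − α (y − y₁)(y₂ − y)(y₂ − y₁)`). -/
theorem kite_quad_nonneg_between {α c₂ c₄ D y₁ y y₂ : ℝ} (hα : α ≤ 0) (h1 : y₁ ≤ y) (h2 : y ≤ y₂)
    (q1 : 0 ≤ α * y₁ ^ 2 - (c₂ + c₄ * D) * y₁ + (c₂ * D + c₄ - α))
    (q2 : 0 ≤ α * y₂ ^ 2 - (c₂ + c₄ * D) * y₂ + (c₂ * D + c₄ - α)) :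
    0 ≤ α * y ^ 2 - (c₂ + c₄ * D) * y + (c₂ * D + c₄ - α) := by
  rcases eq_or_lt_of_le (h1.trans h2) with h | h
  · have hy : y = y₁ := le_antisymm (h ▸ h2) h1
    rw [hy]; exact q1
  have e : (y₂ - y₁) * (α * y ^ 2 - (c₂ + c₄ * D) * y + (c₂ * D + c₄ - α)) =
      (y₂ - y) * (α * y₁ ^ 2 - (c₂ + c₄ * D) * y₁ + (c₂ * D + c₄ - α)) +
        (y - y₁) * (α * y₂ ^ 2 - (c₂ + c₄ * D) * y₂ + (c₂ * D + c₄ - α)) +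
        (-α) * ((y - y₁) * (y₂ - y)) * (y₂ - y₁) := by
    ring
  have hr : (y₂ - y₁) * 0 ≤ (y₂ - y₁) * (α * y ^ 2 - (c₂ + c₄ * D) * y + (c₂ * D + c₄ - α)) := by
    rw [mul_zero, e]
    exact add_nonneg (add_nonneg (mul_nonneg (by linarith) q1) (mul_nonneg (by linarith) q2))
      (mul_nonneg (mul_nonneg (by linarith) (mul_nonneg (by linarith) (by linarith))) (by linarith))
  exact le_of_mul_le_mul_left hr (by linarith)

/-! ## §2 A kite row is bounded by its value at one end -/

section Config

open Literature.Geometry.DiscreteGeometry InnerProductGeometry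

variable {c : Fin 14 → EuclideanSpace ℝ (Fin 3)}

/-- **Kite row with `q ≥ 0` ⇒ at most its value at `|pb| = ρ`.** For an admissible configuration
with `D² < 2`, a P-kite `(p, a, b, e)` and reals `α, c₂, c₄` whose kite quadratic is `≥ 0` on
`[x♭(D), D/2]`: `α u₁ + c₂ u₂ + c₄ u₄ ≤ (α + 2c₄) A_x(D) + 2c₂ A_p(D)`. [folklore] -/
theorem IsGapConfig.kite_row_le_half (hc : IsGapConfig c) (hD2 : intruderDist c ^ 2 < 2)
    {a e b : Fin 14} (ha0 : a ≠ 0) (ha13 : a ≠ 13) (he0 : e ≠ 0) (he13 : e ≠ 13) (hb0 : b ≠ 0)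
    (hb13 : b ≠ 13) (hae : a ≠ e) (ha : dist (c a) (c 13) = 1) (he : dist (c e) (c 13) = 1)
    (hba : dist (c b) (c a) = 1) (hbe : dist (c b) (c e) = 1) (α c₂ c₄ : ℝ)
    (hq : ∀ y ∈ Icc ((intruderDist c - √(6 - 2 * intruderDist c ^ 2)) / 3) (intruderDist c / 2),
      0 ≤ α * y ^ 2 - (c₂ + c₄ * intruderDist c) * y + (c₂ * intruderDist c + c₄ - α)) :
    α * corner c a 13 b + c₂ * corner c 13 a e + c₄ * corner c b a e ≤
      (α + 2 * c₄) * Real.arccos (intruderDist c / (√3 * √(4 - intruderDist c ^ 2))) +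
        2 * c₂ * Real.arccos ((2 - intruderDist c ^ 2) / (4 - intruderDist c ^ 2)) := by
  have hD1 : 1 ≤ intruderDist c := hc.one_le_intruderDist
  have hD0 : 0 < intruderDist c := by linarith
  obtain ⟨hx, hP, h1, h2, h3⟩ :=
    hc.kite_on_curve hD2.le ha0 ha13 he0 he13 hb0 hb13 hae ha he hba hbe
  have hQ := kiteQ_pos_of_flat_nonpos hD0.le hx hP
  have hmono := kiteRow_le_of_quad_nonneg (α := α) (c₂ := c₂) (c₄ := c₄) hD0 hD2 hx le_rfl hQ
    (fun y hy => hq y ⟨(kite_flat_le (by linarith) hP).trans hy.1, hy.2⟩)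
  rw [kiteUa_at_half, kiteUp_at_half hD2.le, kiteUb_at_half hD0.le (by linarith)] at hmono
  rw [h1, h2, h3]
  linarith

/-- **Kite row with `q ≤ 0` ⇒ at most its value at `|ae| = 60°`.** For an admissible configuration
with `D² < 2`, a P-kite `(p, a, b, e)` and reals `α, c₂, c₄` whose kite quadratic is `≤ 0` on
`[x♭(D), D/2]`: `α u₁ + c₂ u₂ + c₄ u₄ ≤ α A_x(D) + c₂ A_p(D) + (α + c₄) arccos (1/3)`. [folklore] -/
theorem IsGapConfig.kite_row_le_flat (hc : IsGapConfig c) (hD2 : intruderDist c ^ 2 < 2)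
    {a e b : Fin 14} (ha0 : a ≠ 0) (ha13 : a ≠ 13) (he0 : e ≠ 0) (he13 : e ≠ 13) (hb0 : b ≠ 0)
    (hb13 : b ≠ 13) (hae : a ≠ e) (ha : dist (c a) (c 13) = 1) (he : dist (c e) (c 13) = 1)
    (hba : dist (c b) (c a) = 1) (hbe : dist (c b) (c e) = 1) (α c₂ c₄ : ℝ)
    (hq : ∀ y ∈ Icc ((intruderDist c - √(6 - 2 * intruderDist c ^ 2)) / 3) (intruderDist c / 2),
      α * y ^ 2 - (c₂ + c₄ * intruderDist c) * y + (c₂ * intruderDist c + c₄ - α) ≤ 0) :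
    α * corner c a 13 b + c₂ * corner c 13 a e + c₄ * corner c b a e ≤
      α * Real.arccos (intruderDist c / (√3 * √(4 - intruderDist c ^ 2))) +
        c₂ * Real.arccos ((2 - intruderDist c ^ 2) / (4 - intruderDist c ^ 2)) +
        (α + c₄) * Real.arccos (1 / 3) := by
  have hD1 : 1 ≤ intruderDist c := hc.one_le_intruderDist
  have hD0 : 0 < intruderDist c := by linarith
  obtain ⟨hx, hP, h1, h2, h3⟩ :=
    hc.kite_on_curve hD2.le ha0 ha13 he0 he13 hb0 hb13 hae ha he hba hbe
  obtain ⟨hroot, h3x⟩ := kite_flat_root (D := intruderDist c) (by linarith)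
  have hfl := kite_flat_le (D := intruderDist c) (by linarith) hP
  have hfh := kite_flat_le_half (D := intruderDist c) hD0.le
  have hQ := kiteQ_pos_of_flat_nonpos hD0.le hfh hroot.le
  have hmono := kiteRow_ge_of_quad_nonpos (α := α) (c₂ := c₂) (c₄ := c₄) hD0 hD2 hfl hx hQ
    (fun y hy => hq y ⟨hy.1, hy.2.trans hx⟩)
  have hxb2 : ((intruderDist c - √(6 - 2 * intruderDist c ^ 2)) / 3) ^ 2 < 1 := by
    nlinarith [mul_le_mul_of_nonneg_left hfh hD0.le]
  rw [kiteUa_at_flat hD0.le (by linarith) h3x hroot, kiteUp_at_flat (by linarith) hxb2 hroot,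
    kiteUb_at_flat hxb2 hroot] at hmono
  rw [h1, h2, h3]
  linarith

/-- **Certified form of `kite_row_le_half` on a `D`-cell** `D_lo ≤ D ≤ D_hi` (`1 ≤ D_lo`,
`D_hi² < 2`, `X_lo ≤ x♭(D_lo)` by the rational test, `D_hi/2 ≤ X_hi`): two Lukács certificates
for `q_{D_lo}`, `q_{D_hi}` on `[X_lo, X_hi]` give the row bound. -/
theorem IsGapConfig.kite_row_le_half_of_cert (hc : IsGapConfig c) {Dlo Dhi Xlo Xhi : ℝ}
    (hlo : Dlo ≤ intruderDist c) (hhi : intruderDist c ≤ Dhi) (hDlo : 0 ≤ Dlo) (hDhi : Dhi ^ 2 < 2)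
    (hX1 : 6 - 2 * Dlo ^ 2 ≤ (Dlo - 3 * Xlo) ^ 2) (hX2 : 3 * Xlo ≤ Dlo) (hX3 : Dhi / 2 ≤ Xhi)
    {a e b : Fin 14} (ha0 : a ≠ 0) (ha13 : a ≠ 13) (he0 : e ≠ 0) (he13 : e ≠ 13) (hb0 : b ≠ 0)
    (hb13 : b ≠ 13) (hae : a ≠ e) (ha : dist (c a) (c 13) = 1) (he : dist (c e) (c 13) = 1)
    (hba : dist (c b) (c a) = 1) (hbe : dist (c b) (c e) = 1) (α c₂ c₄ : ℝ)
    {p₁ v₁ m₁ l₁ p₂ v₂ m₂ l₂ : ℝ}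
    (hp₁ : 0 ≤ p₁) (hm₁ : 0 ≤ m₁) (hl₁ : 0 ≤ l₁) (hp₂ : 0 ≤ p₂) (hm₂ : 0 ≤ m₂) (hl₂ : 0 ≤ l₂)
    (h₁ : ∀ t : ℝ, α * t ^ 2 - (c₂ + c₄ * Dlo) * t + (c₂ * Dlo + c₄ - α) =
      p₁ * (t - v₁) ^ 2 + m₁ + l₁ * ((t - Xlo) * (Xhi - t)))
    (h₂ : ∀ t : ℝ, α * t ^ 2 - (c₂ + c₄ * Dhi) * t + (c₂ * Dhi + c₄ - α) =
      p₂ * (t - v₂) ^ 2 + m₂ + l₂ * ((t - Xlo) * (Xhi - t))) :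
    α * corner c a 13 b + c₂ * corner c 13 a e + c₄ * corner c b a e ≤
      (α + 2 * c₄) * Real.arccos (intruderDist c / (√3 * √(4 - intruderDist c ^ 2))) +
        2 * c₂ * Real.arccos ((2 - intruderDist c ^ 2) / (4 - intruderDist c ^ 2)) := by
  have hD2 : intruderDist c ^ 2 < 2 := by nlinarith
  have hXf : Xlo ≤ (intruderDist c - √(6 - 2 * intruderDist c ^ 2)) / 3 :=
    (kite_le_flat_of_sq hX1 hX2).trans (kite_flat_mono hDlo hlo)
  exact hc.kite_row_le_half hD2 ha0 ha13 he0 he13 hb0 hb13 hae ha he hba hbe α c₂ c₄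
    (fun y hy => kite_quad_nonneg_of_cert hlo hhi (hXf.trans hy.1) (by linarith [hy.2]) hp₁ hm₁ hl₁
      hp₂ hm₂ hl₂ h₁ h₂)

/-- **Certified form of `kite_row_le_flat` on a `D`-cell** (certificates for `−q`). -/
theorem IsGapConfig.kite_row_le_flat_of_cert (hc : IsGapConfig c) {Dlo Dhi Xlo Xhi : ℝ}
    (hlo : Dlo ≤ intruderDist c) (hhi : intruderDist c ≤ Dhi) (hDlo : 0 ≤ Dlo) (hDhi : Dhi ^ 2 < 2)
    (hX1 : 6 - 2 * Dlo ^ 2 ≤ (Dlo - 3 * Xlo) ^ 2) (hX2 : 3 * Xlo ≤ Dlo) (hX3 : Dhi / 2 ≤ Xhi)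
    {a e b : Fin 14} (ha0 : a ≠ 0) (ha13 : a ≠ 13) (he0 : e ≠ 0) (he13 : e ≠ 13) (hb0 : b ≠ 0)
    (hb13 : b ≠ 13) (hae : a ≠ e) (ha : dist (c a) (c 13) = 1) (he : dist (c e) (c 13) = 1)
    (hba : dist (c b) (c a) = 1) (hbe : dist (c b) (c e) = 1) (α c₂ c₄ : ℝ)
    {p₁ v₁ m₁ l₁ p₂ v₂ m₂ l₂ : ℝ}
    (hp₁ : 0 ≤ p₁) (hm₁ : 0 ≤ m₁) (hl₁ : 0 ≤ l₁) (hp₂ : 0 ≤ p₂) (hm₂ : 0 ≤ m₂) (hl₂ : 0 ≤ l₂)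
    (h₁ : ∀ t : ℝ, -(α * t ^ 2 - (c₂ + c₄ * Dlo) * t + (c₂ * Dlo + c₄ - α)) =
      p₁ * (t - v₁) ^ 2 + m₁ + l₁ * ((t - Xlo) * (Xhi - t)))
    (h₂ : ∀ t : ℝ, -(α * t ^ 2 - (c₂ + c₄ * Dhi) * t + (c₂ * Dhi + c₄ - α)) =
      p₂ * (t - v₂) ^ 2 + m₂ + l₂ * ((t - Xlo) * (Xhi - t))) :
    α * corner c a 13 b + c₂ * corner c 13 a e + c₄ * corner c b a e ≤
      α * Real.arccos (intruderDist c / (√3 * √(4 - intruderDist c ^ 2))) +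
        c₂ * Real.arccos ((2 - intruderDist c ^ 2) / (4 - intruderDist c ^ 2)) +
        (α + c₄) * Real.arccos (1 / 3) := by
  have hD2 : intruderDist c ^ 2 < 2 := by nlinarith
  have hXf : Xlo ≤ (intruderDist c - √(6 - 2 * intruderDist c ^ 2)) / 3 :=
    (kite_le_flat_of_sq hX1 hX2).trans (kite_flat_mono hDlo hlo)
  exact hc.kite_row_le_flat hD2 ha0 ha13 he0 he13 hb0 hb13 hae ha he hba hbe α c₂ c₄
    (fun y hy => kite_quad_nonpos_of_cert hlo hhi (hXf.trans hy.1) (by linarith [hy.2]) hp₁ hm₁ hl₁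
      hp₂ hm₂ hl₂ h₁ h₂)

/-- **Valley rows: a kite row with CONCAVE quadratic (`α ≤ 0`) and `q_D(D/2) ≥ 0` is at most the
larger of its two end values** (`q` is then negative-then-nonnegative along the family, so the row
decreases and then increases). [folklore] -/
theorem IsGapConfig.kite_row_le_max_of_concave (hc : IsGapConfig c) (hD2 : intruderDist c ^ 2 < 2)
    {a e b : Fin 14} (ha0 : a ≠ 0) (ha13 : a ≠ 13) (he0 : e ≠ 0) (he13 : e ≠ 13) (hb0 : b ≠ 0)
    (hb13 : b ≠ 13) (hae : a ≠ e) (ha : dist (c a) (c 13) = 1) (he : dist (c e) (c 13) = 1)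
    (hba : dist (c b) (c a) = 1) (hbe : dist (c b) (c e) = 1) (α c₂ c₄ : ℝ) (hα : α ≤ 0)
    (hend : 0 ≤ α * (intruderDist c / 2) ^ 2 - (c₂ + c₄ * intruderDist c) * (intruderDist c / 2) +
      (c₂ * intruderDist c + c₄ - α)) :
    α * corner c a 13 b + c₂ * corner c 13 a e + c₄ * corner c b a e ≤
      max ((α + 2 * c₄) * Real.arccos (intruderDist c / (√3 * √(4 - intruderDist c ^ 2))) +
          2 * c₂ * Real.arccos ((2 - intruderDist c ^ 2) / (4 - intruderDist c ^ 2)))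
        (α * Real.arccos (intruderDist c / (√3 * √(4 - intruderDist c ^ 2))) +
          c₂ * Real.arccos ((2 - intruderDist c ^ 2) / (4 - intruderDist c ^ 2)) +
          (α + c₄) * Real.arccos (1 / 3)) := by
  have hD1 : 1 ≤ intruderDist c := hc.one_le_intruderDist
  have hD0 : 0 < intruderDist c := by linarith
  obtain ⟨hx, hP, h1, h2, h3⟩ :=
    hc.kite_on_curve hD2.le ha0 ha13 he0 he13 hb0 hb13 hae ha he hba hbe
  have hQ := kiteQ_pos_of_flat_nonpos hD0.le hx hP
  rw [h1, h2, h3]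
  by_cases hqx : 0 ≤ α * ⟪gapDir c b, gapDir c 13⟫_ℝ ^ 2 -
      (c₂ + c₄ * intruderDist c) * ⟪gapDir c b, gapDir c 13⟫_ℝ + (c₂ * intruderDist c + c₄ - α)
  · have hmono := kiteRow_le_of_quad_nonneg (α := α) (c₂ := c₂) (c₄ := c₄) hD0 hD2 hx le_rfl hQ
      (fun y hy => kite_quad_nonneg_between hα hy.1 hy.2 hqx hend)
    rw [kiteUa_at_half, kiteUp_at_half hD2.le, kiteUb_at_half hD0.le (by linarith)] at hmono
    exact le_max_of_le_left (by linarith)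
  · have hqx' := lt_of_not_ge hqx
    obtain ⟨hroot, h3x⟩ := kite_flat_root (D := intruderDist c) (by linarith)
    have hfl := kite_flat_le (D := intruderDist c) (by linarith) hP
    have hfh := kite_flat_le_half (D := intruderDist c) hD0.le
    have hQf := kiteQ_pos_of_flat_nonpos hD0.le hfh hroot.le
    have hmono := kiteRow_ge_of_quad_nonpos (α := α) (c₂ := c₂) (c₄ := c₄) hD0 hD2 hfl hx hQf
      (fun y hy => by
        by_contra hy'
        have h' := kite_quad_nonneg_between hα hy.2 hx (lt_of_not_ge hy').le hend
        linarith)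
    have hxb2 : ((intruderDist c - √(6 - 2 * intruderDist c ^ 2)) / 3) ^ 2 < 1 := by
      nlinarith [mul_le_mul_of_nonneg_left hfh hD0.le]
    rw [kiteUa_at_flat hD0.le (by linarith) h3x hroot, kiteUp_at_flat (by linarith) hxb2 hroot,
      kiteUb_at_flat hxb2 hroot] at hmono
    exact le_max_of_le_right (by linarith)

/-- **Certified form of `kite_row_le_max_of_concave` on a `D`-cell**: a Lukács certificate for the
end value `q_D(D/2)` as a quadratic in `D` on `[D_lo, D_hi]`. -/
theorem IsGapConfig.kite_row_le_max_of_concave_of_cert (hc : IsGapConfig c) {Dlo Dhi : ℝ}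
    (hlo : Dlo ≤ intruderDist c) (hhi : intruderDist c ≤ Dhi) (hDhi : Dhi ^ 2 < 2)
    {a e b : Fin 14} (ha0 : a ≠ 0) (ha13 : a ≠ 13) (he0 : e ≠ 0) (he13 : e ≠ 13) (hb0 : b ≠ 0)
    (hb13 : b ≠ 13) (hae : a ≠ e) (ha : dist (c a) (c 13) = 1) (he : dist (c e) (c 13) = 1)
    (hba : dist (c b) (c a) = 1) (hbe : dist (c b) (c e) = 1) (α c₂ c₄ : ℝ) (hα : α ≤ 0)
    {p v m l : ℝ} (hp : 0 ≤ p) (hm : 0 ≤ m) (hl : 0 ≤ l)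
    (h : ∀ t : ℝ, α * (t / 2) ^ 2 - (c₂ + c₄ * t) * (t / 2) + (c₂ * t + c₄ - α) =
      p * (t - v) ^ 2 + m + l * ((t - Dlo) * (Dhi - t))) :
    α * corner c a 13 b + c₂ * corner c 13 a e + c₄ * corner c b a e ≤
      max ((α + 2 * c₄) * Real.arccos (intruderDist c / (√3 * √(4 - intruderDist c ^ 2))) +
          2 * c₂ * Real.arccos ((2 - intruderDist c ^ 2) / (4 - intruderDist c ^ 2)))
        (α * Real.arccos (intruderDist c / (√3 * √(4 - intruderDist c ^ 2))) +
          c₂ * Real.arccos ((2 - intruderDist c ^ 2) / (4 - intruderDist c ^ 2)) +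
          (α + c₄) * Real.arccos (1 / 3)) := by
  have hD1 : 1 ≤ intruderDist c := hc.one_le_intruderDist
  have hD2 : intruderDist c ^ 2 < 2 := by nlinarith
  refine hc.kite_row_le_max_of_concave hD2 ha0 ha13 he0 he13 hb0 hb13 hae ha he hba hbe α c₂ c₄ hα ?_
  rw [h]
  exact quad_cert_nonneg hlo hhi hp hm hl

/-- **Peak rows: if the quadratic is `≥ 0` before a parameter `s` and `≤ 0` after it, the row is at
most its value AT `s`** (`x♭(D) ≤ s ≤ D/2`). [folklore] -/
theorem IsGapConfig.kite_row_le_at (hc : IsGapConfig c) (hD2 : intruderDist c ^ 2 < 2)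
    {a e b : Fin 14} (ha0 : a ≠ 0) (ha13 : a ≠ 13) (he0 : e ≠ 0) (he13 : e ≠ 13) (hb0 : b ≠ 0)
    (hb13 : b ≠ 13) (hae : a ≠ e) (ha : dist (c a) (c 13) = 1) (he : dist (c e) (c 13) = 1)
    (hba : dist (c b) (c a) = 1) (hbe : dist (c b) (c e) = 1) (α c₂ c₄ s : ℝ)
    (hs1 : (intruderDist c - √(6 - 2 * intruderDist c ^ 2)) / 3 ≤ s) (hs2 : s ≤ intruderDist c / 2)
    (hq1 : ∀ y ∈ Icc ((intruderDist c - √(6 - 2 * intruderDist c ^ 2)) / 3) s,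
      0 ≤ α * y ^ 2 - (c₂ + c₄ * intruderDist c) * y + (c₂ * intruderDist c + c₄ - α))
    (hq2 : ∀ y ∈ Icc s (intruderDist c / 2),
      α * y ^ 2 - (c₂ + c₄ * intruderDist c) * y + (c₂ * intruderDist c + c₄ - α) ≤ 0) :
    α * corner c a 13 b + c₂ * corner c 13 a e + c₄ * corner c b a e ≤
      α * Real.arccos ((4 * s - intruderDist c) / (√3 * √(4 - intruderDist c ^ 2))) +
        c₂ * Real.arccos (((4 + intruderDist c ^ 2) * s ^ 2 - 4 * intruderDist c * s +
          intruderDist c ^ 2 - 2) / ((4 - intruderDist c ^ 2) * (1 - s ^ 2))) +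
        c₄ * Real.arccos ((5 * s ^ 2 - 4 * intruderDist c * s + 2 * intruderDist c ^ 2 - 3) /
          (3 * (1 - s ^ 2))) := by
  have hD1 : 1 ≤ intruderDist c := hc.one_le_intruderDist
  have hD0 : 0 < intruderDist c := by linarith
  obtain ⟨hx, hP, h1, h2, h3⟩ :=
    hc.kite_on_curve hD2.le ha0 ha13 he0 he13 hb0 hb13 hae ha he hba hbe
  have hQ := kiteQ_pos_of_flat_nonpos hD0.le hx hP
  have hfl := kite_flat_le (D := intruderDist c) (by linarith) hP
  rw [h1, h2, h3]
  rcases le_total ⟪gapDir c b, gapDir c 13⟫_ℝ s with hxs | hsx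
  · exact kiteRow_le_of_quad_nonneg (α := α) (c₂ := c₂) (c₄ := c₄) hD0 hD2 hxs hs2 hQ
      (fun y hy => hq1 y ⟨hfl.trans hy.1, hy.2⟩)
  · obtain ⟨hroot, -⟩ := kite_flat_root (D := intruderDist c) (by linarith)
    have hfh := kite_flat_le_half (D := intruderDist c) hD0.le
    have hQf := kiteQ_pos_of_flat_nonpos hD0.le hfh hroot.le
    have hQs := kiteQ_pos_of_le (by linarith) hQf hs1 hs2
    exact kiteRow_ge_of_quad_nonpos (α := α) (c₂ := c₂) (c₄ := c₄) hD0 hD2 hsx hx hQs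
      (fun y hy => hq2 y ⟨hy.1, hy.2.trans hx⟩)

/-- **Peak at `s = 0` (`|pb| = 90°`), certified on a `D`-cell**: Lukács certificates for `q` on
`[X_lo, 0]` and for `−q` on `[0, X_hi]` at both ends of the cell give
`α u₁ + c₂ u₂ + c₄ u₄ ≤ α (π − A_x(D)) + c₂ (π − A_p(D)) + c₄ arccos ((2D² − 3)/3)`. [folklore] -/
theorem IsGapConfig.kite_row_le_at_zero_of_cert (hc : IsGapConfig c) {Dlo Dhi Xlo Xhi : ℝ}
    (hlo : Dlo ≤ intruderDist c) (hhi : intruderDist c ≤ Dhi) (hDlo : 0 ≤ Dlo) (hDhi : Dhi ^ 2 < 2)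
    (hX1 : 6 - 2 * Dlo ^ 2 ≤ (Dlo - 3 * Xlo) ^ 2) (hX2 : 3 * Xlo ≤ Dlo) (hX3 : Dhi / 2 ≤ Xhi)
    {a e b : Fin 14} (ha0 : a ≠ 0) (ha13 : a ≠ 13) (he0 : e ≠ 0) (he13 : e ≠ 13) (hb0 : b ≠ 0)
    (hb13 : b ≠ 13) (hae : a ≠ e) (ha : dist (c a) (c 13) = 1) (he : dist (c e) (c 13) = 1)
    (hba : dist (c b) (c a) = 1) (hbe : dist (c b) (c e) = 1) (α c₂ c₄ : ℝ)
    {p₁ v₁ m₁ l₁ p₂ v₂ m₂ l₂ p₃ v₃ m₃ l₃ p₄ v₄ m₄ l₄ : ℝ}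
    (hp₁ : 0 ≤ p₁) (hm₁ : 0 ≤ m₁) (hl₁ : 0 ≤ l₁) (hp₂ : 0 ≤ p₂) (hm₂ : 0 ≤ m₂) (hl₂ : 0 ≤ l₂)
    (hp₃ : 0 ≤ p₃) (hm₃ : 0 ≤ m₃) (hl₃ : 0 ≤ l₃) (hp₄ : 0 ≤ p₄) (hm₄ : 0 ≤ m₄) (hl₄ : 0 ≤ l₄)
    (h₁ : ∀ t : ℝ, α * t ^ 2 - (c₂ + c₄ * Dlo) * t + (c₂ * Dlo + c₄ - α) =
      p₁ * (t - v₁) ^ 2 + m₁ + l₁ * ((t - Xlo) * (0 - t)))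
    (h₂ : ∀ t : ℝ, α * t ^ 2 - (c₂ + c₄ * Dhi) * t + (c₂ * Dhi + c₄ - α) =
      p₂ * (t - v₂) ^ 2 + m₂ + l₂ * ((t - Xlo) * (0 - t)))
    (h₃ : ∀ t : ℝ, -(α * t ^ 2 - (c₂ + c₄ * Dlo) * t + (c₂ * Dlo + c₄ - α)) =
      p₃ * (t - v₃) ^ 2 + m₃ + l₃ * ((t - 0) * (Xhi - t)))
    (h₄ : ∀ t : ℝ, -(α * t ^ 2 - (c₂ + c₄ * Dhi) * t + (c₂ * Dhi + c₄ - α)) =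
      p₄ * (t - v₄) ^ 2 + m₄ + l₄ * ((t - 0) * (Xhi - t))) :
    α * corner c a 13 b + c₂ * corner c 13 a e + c₄ * corner c b a e ≤
      α * (π - Real.arccos (intruderDist c / (√3 * √(4 - intruderDist c ^ 2)))) +
        c₂ * (π - Real.arccos ((2 - intruderDist c ^ 2) / (4 - intruderDist c ^ 2))) +
        c₄ * Real.arccos ((2 * intruderDist c ^ 2 - 3) / 3) := by
  have hD1 : 1 ≤ intruderDist c := hc.one_le_intruderDist
  have hD2 : intruderDist c ^ 2 < 2 := by nlinarith
  have hXf : Xlo ≤ (intruderDist c - √(6 - 2 * intruderDist c ^ 2)) / 3 :=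
    (kite_le_flat_of_sq hX1 hX2).trans (kite_flat_mono hDlo hlo)
  have hs1 : (intruderDist c - √(6 - 2 * intruderDist c ^ 2)) / 3 ≤ 0 := by
    have h6 : intruderDist c ≤ √(6 - 2 * intruderDist c ^ 2) :=
      calc intruderDist c = √(intruderDist c ^ 2) := (Real.sqrt_sq (by linarith)).symm
        _ ≤ √(6 - 2 * intruderDist c ^ 2) := Real.sqrt_le_sqrt (by nlinarith)
    linarith
  have h := hc.kite_row_le_at hD2 ha0 ha13 he0 he13 hb0 hb13 hae ha he hba hbe α c₂ c₄ 0 hs1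
    (by linarith)
    (fun y hy => kite_quad_nonneg_of_cert hlo hhi (hXf.trans hy.1) hy.2 hp₁ hm₁ hl₁ hp₂ hm₂ hl₂
      h₁ h₂)
    (fun y hy => kite_quad_nonpos_of_cert hlo hhi hy.1 (by linarith [hy.2]) hp₃ hm₃ hl₃ hp₄ hm₄
      hl₄ h₃ h₄)
  have e1 : Real.arccos ((4 * 0 - intruderDist c) / (√3 * √(4 - intruderDist c ^ 2))) =
      π - Real.arccos (intruderDist c / (√3 * √(4 - intruderDist c ^ 2))) := by
    rw [← Real.arccos_neg]; congr 1; ring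
  have e2 : Real.arccos (((4 + intruderDist c ^ 2) * 0 ^ 2 - 4 * intruderDist c * 0 +
      intruderDist c ^ 2 - 2) / ((4 - intruderDist c ^ 2) * (1 - 0 ^ 2))) =
      π - Real.arccos ((2 - intruderDist c ^ 2) / (4 - intruderDist c ^ 2)) := by
    rw [← Real.arccos_neg]; congr 1; ring
  have e3 : Real.arccos ((5 * 0 ^ 2 - 4 * intruderDist c * 0 + 2 * intruderDist c ^ 2 - 3) /
      (3 * (1 - 0 ^ 2))) = Real.arccos ((2 * intruderDist c ^ 2 - 3) / 3) := by
    congr 1; ring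
  rw [e1, e2, e3] at h
  exact h

end Config

end Summit.Ventures.Crystal3D

end
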